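import Summits.ValiantsHypothesis.ValiantsHypothesis.Theorems.LacunarySymmetroidMatrixDescartesCensusDoorA34ConfluentNineNewton

/-!
# `MatrixDescartes` census — DOOR A at `(3,4)`: THE CONFLUENT NINE, part 5 — the WALL DIRECTION `3S₁ − (4+√7)S₂` closes
# chamber III: no ninefold root for symmetric letters on the whole open chamber `3d₁ < 2d₂ < 4d₁`; the one-line law «`d₂ > 2d₁` ⇒ no
# ninefold root» (sum of squares); and the all-supports corollary «a coalesced nine is never of PSD type» (every support off two walls)

HONEST FRAMING.  Object-search cell `pub-symmetroid`, door-A seat `val-sym-door-p3` (g25); helper file beside the OPEN typed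
statement `DoorA34 = PosRootLawAt 3 4 18` (route item `Theses.LacunarySymmetroid.DoorA34`, stmt-ValiantsHypothesis-19980),
asserted nowhere here.  Parts 1–4 (`…ConfluentNineKernel`, `…ConfluentNine`, `…ConfluentNineTable`, `…ConfluentNineNewton`) left
the sliver `19d₁ < 10d₂ < 20d₁` of chamber III open: there Newton's inequalities hold for every real combination of the letters and
only the full discriminant of `t ↦ det(t·1 + N)` fails, on a window of directions that closes up, as `d₂/d₁ → 2`, onto the single
direction `σ_∞ = −(4+√7)/3` (the limiting discriminant is the square `(3σ² + 8σ + 3)²`).  This part uses exactly that direction: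

* **`not_ninefold_root_chamber_III_wall`** (ALL supports with `9d₁ ≤ 5d₂` and `d₂ < 2d₁`; `S₁, S₂` symmetric; any `x₀`):
  `(X − x₀)⁹ ∤ det(1 + X^{d₁}S₁ + X^{d₂}S₂)`.  Certificate: with `N = 3·x₀^{d₁}S₁ − (4+√7)·x₀^{d₂}S₂` and the confluent table,
  `Disc(N)·((L₁L₂)²L₃)² = A + √7·B` where `A = −529200·d₁⁶d₂⁶(d₂−d₁)¹²(2d₁−d₂)⁷(2d₂−d₁)⁷(2d₂−3d₁)³(3d₂−2d₁)³(d₂−3d₁)²(3d₂−d₁)²·R_A`,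
  `B = −5292000·(same with (3d₂−2d₁)⁴)·R_B`, `R_A` (degree 14) and `R_B` (degree 13) POSITIVE on the range by the certificates
  `R_A(d₁,d₂) = Q_A(2d₁−d₂, 5d₂−9d₁)`, `R_B = Q_B(…)` with `Q_A, Q_B` forms with positive integer coefficients — against
  `Disc(N) ≥ 0` (`NoNinefold.discr_charpoly_nonneg_of_isSymm`).
* **`not_ninefold_root_chamber_III'`**: the whole open chamber III `3d₁ < 2d₂ ∧ d₂ < 2d₁` (Newton part for `10d₂ ≤ 19d₁`, wall part beyond).
* **`three_e2_le_trace_sq_of_isSymm`** (sum of squares) and **`not_ninefold_root_of_two_mul_lt`** (ALL supports with `2d₁ < d₂` —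
  chambers I, II and the wall `d₂ = 3d₁`; `S₁` symmetric, `S₂` ARBITRARY; any `x₀`): no ninefold root at all, because the table forces
  `(tr S₁)² − 3e₂(S₁) = −135 s²(s+2)(2s+1)(13s²−s−5)/((s−1)²(2s−1)²(3s−1)²(s−2)(3s−2)) < 0` (`s = d₂/d₁`) — the middle letter alone
  cannot be symmetric (supersedes part 4's chamber-I law, upgrades chamber II from «pseudoline contact» to «impossible»).
* **`not_posSemidef_of_ninefold_root_offwalls`** (EVERY support `0 < d₁ < d₂` off the two walls `d₂ = 2d₁`, `2d₂ = 3d₁`, symmetric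
  letters, any `x₀`): a ninefold root of `det(1 + X^{d₁}S₁ + X^{d₂}S₂)` is NEVER a PSD-singular point — `d₂ > 2d₁` and chamber III:
  no ninefold root at all; chamber IV: pseudoline contact (part 2).  THE COALESCED CORNER OF CLAIM L, ALL SUPPORTS, IN THE KERNEL.

Nothing here bounds `ζ_sym(3,3)` or `ζ_sym(3,4)` («no 9-fold contact does not by itself bound the count»); `DoorA34`, Claim L on
`d₂ < 2d₁` and `MatrixDescartes` (stmt-ValiantsHypothesis-18050) stay OPEN; registers unchanged; nothing on `VP ≠ VNP`.
[folklore] discriminant of a real-rooted cubic, the spectral theorem; certificates by `ring` / `linear_combination` / `positivity`.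
-/

-- `Summit.ValiantsHypothesis.ValiantsHypothesis.…` repeats a component by the D-0017 layout
-- (single-conjunct summit), which the `dupNamespace` linter flags; the name is mandated.
set_option linter.dupNamespace false

namespace Summit.ValiantsHypothesis.ValiantsHypothesis.Theorems.LacunarySymmetroidMatrixDescartes.Census.ConfluentNine

open Polynomial Finset
open scoped BigOperators

/-! ## 6. Chamber III up to the wall `d₂ = 2d₁`: the direction `3S₁ − (4+√7)S₂` -/

/-- Reduction of the cleared discriminant modulo `ρ² = 7` at the level of the atoms `Pₖ = uₖ + ρ vₖ`. [folklore] -/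
theorem wall_reduction (u₁ v₁ u₂ v₂ u₃ v₃ L₁ L₂ L₃ ρ P₁ P₂ P₃ : ℝ) (hρ : ρ ^ 2 = 7) (hP1 : P₁ = u₁ + ρ * v₁)
    (hP2 : P₂ = u₂ + ρ * v₂) (hP3 : P₃ = u₃ + ρ * v₃) :
    18 * P₁ * P₂ * P₃ * L₁ ^ 3 * L₂ ^ 3 * L₃ - 4 * P₁ ^ 3 * P₃ * L₁ * L₂ ^ 4 * L₃ + P₁ ^ 2 * P₂ ^ 2 * L₁ ^ 2 * L₂ ^ 2 * L₃ ^ 2 - 4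
      * P₂ ^ 3 * L₁ ^ 4 * L₂ * L₃ ^ 2 - 27 * P₃ ^ 2 * L₁ ^ 4 * L₂ ^ 4
      = (18 * L₁^3 * L₂^3 * L₃ * (u₁*u₂*u₃ + 7 * (u₁*v₂*v₃ + v₁*u₂*v₃ + v₁*v₂*u₃) + 49 * 0) + (-4) * L₁ * L₂^4 * L₃ * (u₁^3*u₃ + 7 * (3*u₁^2*v₁*v₃
          + 3*u₁*v₁^2*u₃) + 49 * v₁^3*v₃) + L₁^2 * L₂^2 * L₃^2 * (u₁^2*u₂^2 + 7 * (u₁^2*v₂^2 + 4*u₁*v₁*u₂*v₂ + v₁^2*u₂^2) + 49 * v₁^2*v₂^2) + (-4)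
          * L₁^4 * L₂ * L₃^2 * (u₂^3 + 7 * 3*u₂*v₂^2 + 49 * 0) + (-27) * L₁^4 * L₂^4 * (u₃^2 + 7 * v₃^2 + 49 * 0)) + ρ * (18 * L₁^3 * L₂^3 * L₃
          * ((u₁*u₂*v₃ + u₁*v₂*u₃ + v₁*u₂*u₃) + 7 * v₁*v₂*v₃) + (-4) * L₁ * L₂^4 * L₃ * ((u₁^3*v₃ + 3*u₁^2*v₁*u₃) + 7 * (3*u₁*v₁^2*v₃ + v₁^3*u₃))
          + L₁^2 * L₂^2 * L₃^2 * ((2*u₁^2*u₂*v₂ + 2*u₁*v₁*u₂^2) + 7 * (2*u₁*v₁*v₂^2 + 2*v₁^2*u₂*v₂)) + (-4) * L₁^4 * L₂ * L₃^2 * (3*u₂^2*v₂ + 7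
          * v₂^3) + (-27) * L₁^4 * L₂^4 * (2*u₃*v₃ + 7 * 0)) := by
  rw [hP1, hP2, hP3]
  linear_combination (18 * L₁^3 * L₂^3 * L₃ * (((u₁*v₂*v₃ + v₁*u₂*v₃ + v₁*v₂*u₃) + 7 * 0) + ρ * v₁*v₂*v₃ + ρ^2 * 0) + (-4) * L₁ * L₂^4 * L₃
        * (((3*u₁^2*v₁*v₃ + 3*u₁*v₁^2*u₃) + 7 * v₁^3*v₃) + ρ * (3*u₁*v₁^2*v₃ + v₁^3*u₃) + ρ^2 * v₁^3*v₃) + L₁^2 * L₂^2 * L₃^2 * (((u₁^2*v₂^2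
        + 4*u₁*v₁*u₂*v₂ + v₁^2*u₂^2) + 7 * v₁^2*v₂^2) + ρ * (2*u₁*v₁*v₂^2 + 2*v₁^2*u₂*v₂) + ρ^2 * v₁^2*v₂^2) + (-4) * L₁^4 * L₂ * L₃^2
        * ((3*u₂*v₂^2 + 7 * 0) + ρ * v₂^3 + ρ^2 * 0) + (-27) * L₁^4 * L₂^4 * ((v₃^2 + 7 * 0) + ρ * 0 + ρ^2 * 0)) * hρ

set_option maxHeartbeats 2000000 in
/-- **NO NINEFOLD ROOT IN CHAMBER III beyond `9d₁ ≤ 5d₂` (all such supports).**  For ANY support with `9d₁ ≤ 5d₂ < 10d₁`, any real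
SYMMETRIC letters and any `x₀`, `(X − x₀)⁹ ∤ det(1 + X^{d₁}S₁ + X^{d₂}S₂)`: the discriminant of the characteristic polynomial of the
symmetric matrix `3·x₀^{d₁}S₁ − (4+√7)·x₀^{d₂}S₂` would be negative. [folklore] -/
theorem not_ninefold_root_chamber_III_wall (d₁ d₂ : ℕ) (S₁ S₂ : Matrix (Fin 3) (Fin 3) ℝ) (hlo : 9 * d₁ ≤ 5 * d₂)
    (hhi : d₂ < 2 * d₁) (hS₁ : S₁.IsSymm) (hS₂ : S₂.IsSymm) (x₀ : ℝ) :
    ¬ (X - C x₀) ^ 9 ∣ (∑ l, (X : ℝ[X]) ^ (![0, d₁, d₂] : Fin 3 → ℕ) l • ((![1, S₁, S₂] : Fin 3 → Matrix (Fin 3) (Fin 3) ℝ) l).map C).det := by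
  intro h9
  have h := dvd_comp_scale h9
  rw [det_pencil_comp_scale] at h
  have h0 : 0 < d₁ := by omega
  obtain ⟨C1, C2, C3, C4, C5, C6, C7, C8, C9⟩ := confluent_coefficients d₁ d₂ (x₀ ^ d₁ • S₁) (x₀ ^ d₂ • S₂) h0 (by omega) h
  have ha : (0 : ℝ) < d₁ := by exact_mod_cast h0
  have hlo' : 9 * (d₁ : ℝ) ≤ 5 * d₂ := by exact_mod_cast hlo
  have hhi' : (d₂ : ℝ) < 2 * d₁ := by exact_mod_cast hhi
  have p1 : 0 < (d₂ : ℝ) - (d₁ : ℝ) := by linarith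
  have pu : 0 < 2 * (d₁ : ℝ) - (d₂ : ℝ) := by linarith
  have n2 : (d₂ : ℝ) - 2 * (d₁ : ℝ) ≠ 0 := by intro hh; linarith
  have n3 : (d₂ : ℝ) - 3 * (d₁ : ℝ) ≠ 0 := by intro hh; linarith
  have p4 : 0 < 2 * (d₂ : ℝ) - (d₁ : ℝ) := by linarith
  have p5 : 0 < 2 * (d₂ : ℝ) - 3 * (d₁ : ℝ) := by linarith
  have p6 : 0 < 3 * (d₂ : ℝ) - (d₁ : ℝ) := by linarith
  have p6' : 0 < 3 * (d₂ : ℝ) - 2 * (d₁ : ℝ) := by linarith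
  have p7 : 0 < (d₂ : ℝ) := by linarith
  -- √7
  obtain ⟨ρ, hρdef⟩ : ∃ ρ : ℝ, ρ = Real.sqrt 7 := ⟨_, rfl⟩
  have hρ : ρ ^ 2 = 7 := by rw [hρdef, Real.sq_sqrt (by norm_num)]
  have hρ0 : 0 < ρ := by rw [hρdef]; exact Real.sqrt_pos.mpr (by norm_num)
  -- certificates (done early, in a small context)
  obtain ⟨u, hu⟩ : ∃ u : ℝ, u = 2 * (d₁ : ℝ) - (d₂ : ℝ) := ⟨_, rfl⟩
  obtain ⟨v, hv⟩ : ∃ v : ℝ, v = 5 * (d₂ : ℝ) - 9 * (d₁ : ℝ) := ⟨_, rfl⟩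
  have hu0 : 0 < u := by rw [hu]; linarith
  have hv0 : 0 ≤ v := by rw [hv]; linarith
  have hRA : 0 < (-59525894244) * (d₁ : ℝ) ^ 14 + (463050662104) * (d₁ : ℝ) ^ 13 * (d₂ : ℝ) + (-1338534940339) * (d₁ : ℝ) ^ 12 * (d₂ : ℝ) ^ 2
      + (1362621789444) * (d₁ : ℝ) ^ 11 * (d₂ : ℝ) ^ 3 + (993632267146) * (d₁ : ℝ) ^ 10 * (d₂ : ℝ) ^ 4 + (-2964615634660) * (d₁ : ℝ) ^ 9
      * (d₂ : ℝ) ^ 5 + (600149827125) * (d₁ : ℝ) ^ 8 * (d₂ : ℝ) ^ 6 + (2673509222000) * (d₁ : ℝ) ^ 7 * (d₂ : ℝ) ^ 7 + (-1838103286325)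
      * (d₁ : ℝ) ^ 6 * (d₂ : ℝ) ^ 8 + (-659250033660) * (d₁ : ℝ) ^ 5 * (d₂ : ℝ) ^ 9 + (1139411739446) * (d₁ : ℝ) ^ 4 * (d₂ : ℝ) ^ 10
      + (-206564521556) * (d₁ : ℝ) ^ 3 * (d₂ : ℝ) ^ 11 + (-318452034189) * (d₁ : ℝ) ^ 2 * (d₂ : ℝ) ^ 12 + (200622496104) * (d₁ : ℝ) * (d₂ : ℝ) ^ 13
      + (-35475698844) * (d₂ : ℝ) ^ 14 := by
    have e : (-59525894244) * (d₁ : ℝ) ^ 14 + (463050662104) * (d₁ : ℝ) ^ 13 * (d₂ : ℝ) + (-1338534940339) * (d₁ : ℝ) ^ 12 * (d₂ : ℝ) ^ 2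
        + (1362621789444) * (d₁ : ℝ) ^ 11 * (d₂ : ℝ) ^ 3 + (993632267146) * (d₁ : ℝ) ^ 10 * (d₂ : ℝ) ^ 4 + (-2964615634660) * (d₁ : ℝ) ^ 9
        * (d₂ : ℝ) ^ 5 + (600149827125) * (d₁ : ℝ) ^ 8 * (d₂ : ℝ) ^ 6 + (2673509222000) * (d₁ : ℝ) ^ 7 * (d₂ : ℝ) ^ 7 + (-1838103286325)
        * (d₁ : ℝ) ^ 6 * (d₂ : ℝ) ^ 8 + (-659250033660) * (d₁ : ℝ) ^ 5 * (d₂ : ℝ) ^ 9 + (1139411739446) * (d₁ : ℝ) ^ 4 * (d₂ : ℝ) ^ 10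
        + (-206564521556) * (d₁ : ℝ) ^ 3 * (d₂ : ℝ) ^ 11 + (-318452034189) * (d₁ : ℝ) ^ 2 * (d₂ : ℝ) ^ 12 + (200622496104) * (d₁ : ℝ)
        * (d₂ : ℝ) ^ 13 + (-35475698844) * (d₂ : ℝ) ^ 14
        = (120156316881493600896) * u ^ 14 + (1003406613697843579168) * u ^ 13 * v + (2359235592877854993904) * u ^ 12 * v ^ 2
            + (2897749399510172658192) * u ^ 11 * v ^ 3 + (2249976601410358120416) * u ^ 10 * v ^ 4 + (1206124861330527143946) * u ^ 9 * v ^ 5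
            + (467720929743815292903) * u ^ 8 * v ^ 6 + (134503972108380006584) * u ^ 7 * v ^ 7 + (28985288076579845702) * u ^ 6 * v ^ 8
            + (4674878092724730816) * u ^ 5 * v ^ 9 + (556823087241785460) * u ^ 4 * v ^ 10 + (47571268144309200) * u ^ 3 * v ^ 11
            + (2758432149383625) * u ^ 2 * v ^ 12 + (97224403882500) * u * v ^ 13 + (1571724000000) * v ^ 14 := by
      rw [hu, hv]; ring
    rw [e]; positivity
  have hRB : 0 < (1113747900) * (d₁ : ℝ) ^ 13 + (-7017297452) * (d₁ : ℝ) ^ 12 * (d₂ : ℝ) + (14671752647) * (d₁ : ℝ) ^ 11 * (d₂ : ℝ) ^ 2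
      + (-3813259764) * (d₁ : ℝ) ^ 10 * (d₂ : ℝ) ^ 3 + (-24136023938) * (d₁ : ℝ) ^ 9 * (d₂ : ℝ) ^ 4 + (19619096618) * (d₁ : ℝ) ^ 8 * (d₂ : ℝ) ^ 5
      + (17497339338) * (d₁ : ℝ) ^ 7 * (d₂ : ℝ) ^ 6 + (-23430682618) * (d₁ : ℝ) ^ 6 * (d₂ : ℝ) ^ 7 + (-212204738) * (d₁ : ℝ) ^ 5 * (d₂ : ℝ) ^ 8
      + (11193902178) * (d₁ : ℝ) ^ 4 * (d₂ : ℝ) ^ 9 + (-4427276077) * (d₁ : ℝ) ^ 3 * (d₂ : ℝ) ^ 10 + (-2300819210) * (d₁ : ℝ) ^ 2 * (d₂ : ℝ) ^ 11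
      + (2139681684) * (d₁ : ℝ) * (d₂ : ℝ) ^ 12 + (-434322936) * (d₂ : ℝ) ^ 13 := by
    have e : (1113747900) * (d₁ : ℝ) ^ 13 + (-7017297452) * (d₁ : ℝ) ^ 12 * (d₂ : ℝ) + (14671752647) * (d₁ : ℝ) ^ 11 * (d₂ : ℝ) ^ 2 + (-3813259764)
        * (d₁ : ℝ) ^ 10 * (d₂ : ℝ) ^ 3 + (-24136023938) * (d₁ : ℝ) ^ 9 * (d₂ : ℝ) ^ 4 + (19619096618) * (d₁ : ℝ) ^ 8 * (d₂ : ℝ) ^ 5 + (17497339338)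
        * (d₁ : ℝ) ^ 7 * (d₂ : ℝ) ^ 6 + (-23430682618) * (d₁ : ℝ) ^ 6 * (d₂ : ℝ) ^ 7 + (-212204738) * (d₁ : ℝ) ^ 5 * (d₂ : ℝ) ^ 8 + (11193902178)
        * (d₁ : ℝ) ^ 4 * (d₂ : ℝ) ^ 9 + (-4427276077) * (d₁ : ℝ) ^ 3 * (d₂ : ℝ) ^ 10 + (-2300819210) * (d₁ : ℝ) ^ 2 * (d₂ : ℝ) ^ 11 + (2139681684)
        * (d₁ : ℝ) * (d₂ : ℝ) ^ 12 + (-434322936) * (d₂ : ℝ) ^ 13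
        = (272431074847188576) * u ^ 13 + (2192488500646459808) * u ^ 12 * v + (4781532309403154416) * u ^ 11 * v ^ 2 + (5378605623886778176)
            * u ^ 10 * v ^ 3 + (3784107232490301862) * u ^ 9 * v ^ 4 + (1817055837630538222) * u ^ 8 * v ^ 5 + (622716864856960102) * u ^ 7 * v ^ 6
            + (155639650415325932) * u ^ 6 * v ^ 7 + (28529791728945915) * u ^ 5 * v ^ 8 + (3801816151024563) * u ^ 4 * v ^ 9 + (358818358199805)
            * u ^ 3 * v ^ 10 + (22746810498975) * u ^ 2 * v ^ 11 + (868827060000) * u * v ^ 12 + (15104880000) * v ^ 13 := by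
      rw [hu, hv]; ring
    rw [e]; positivity
  have hprefA : 0 < ((d₁ : ℝ) ^ 6 * (d₂ : ℝ) ^ 6 * ((d₂ : ℝ) - (d₁ : ℝ)) ^ 12 * (2 * (d₁ : ℝ) - (d₂ : ℝ)) ^ 7 * (2 * (d₂ : ℝ) - (d₁ : ℝ)) ^ 7 * (2
      * (d₂ : ℝ) - 3 * (d₁ : ℝ)) ^ 3 * (3 * (d₂ : ℝ) - 2 * (d₁ : ℝ)) ^ 3 * ((d₂ : ℝ) - 3 * (d₁ : ℝ)) ^ 2 * (3 * (d₂ : ℝ)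
      - (d₁ : ℝ)) ^ 2) := by positivity
  have hprefB : 0 < ((d₁ : ℝ) ^ 6 * (d₂ : ℝ) ^ 6 * ((d₂ : ℝ) - (d₁ : ℝ)) ^ 12 * (2 * (d₁ : ℝ) - (d₂ : ℝ)) ^ 7 * (2 * (d₂ : ℝ) - (d₁ : ℝ)) ^ 7 * (2
      * (d₂ : ℝ) - 3 * (d₁ : ℝ)) ^ 3 * (3 * (d₂ : ℝ) - 2 * (d₁ : ℝ)) ^ 4 * ((d₂ : ℝ) - 3 * (d₁ : ℝ)) ^ 2 * (3 * (d₂ : ℝ)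
      - (d₁ : ℝ)) ^ 2) := by positivity
  -- the symmetric combination N = 3 T₁ − (4 + √7) T₂ and its discriminant
  have hNsymm : ((3 : ℝ) • (x₀ ^ d₁ • S₁) + (-(4 + ρ)) • (x₀ ^ d₂ • S₂)).IsSymm := (hS₁.smul _).smul _ |>.add ((hS₂.smul _).smul _)
  have hD := NoNinefold.discr_charpoly_nonneg_of_isSymm _ hNsymm
  obtain ⟨L₁, hL1⟩ : ∃ L₁ : ℝ, L₁ =
      (((d₂ : ℝ) - (d₁ : ℝ)) * (2 * (d₂ : ℝ) - (d₁ : ℝ)) * (3 * (d₂ : ℝ) - (d₁ : ℝ)) * ((d₂ : ℝ) - 2 * (d₁ : ℝ)) * ((d₂ : ℝ) - 3 * (d₁ : ℝ))) := ⟨_, rfl⟩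
  obtain ⟨L₂, hL2⟩ : ∃ L₂ : ℝ, L₂ =
      (((d₂ : ℝ) - (d₁ : ℝ)) ^ 2 * ((d₂ : ℝ) - 2 * (d₁ : ℝ)) * (2 * (d₂ : ℝ) - (d₁ : ℝ)) * (3 * (d₂ : ℝ) - 2 * (d₁ : ℝ)) * (2 * (d₂ : ℝ)
      - 3 * (d₁ : ℝ))) := ⟨_, rfl⟩
  obtain ⟨L₃, hL3⟩ : ∃ L₃ : ℝ, L₃ =
      (((d₂ : ℝ) - (d₁ : ℝ)) ^ 3 * ((d₂ : ℝ) - 2 * (d₁ : ℝ)) * ((d₂ : ℝ) - 3 * (d₁ : ℝ)) * (2 * (d₂ : ℝ) - 3 * (d₁ : ℝ)) * (2 * (d₂ : ℝ)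
      - (d₁ : ℝ)) * (3 * (d₂ : ℝ) - (d₁ : ℝ)) * (3 * (d₂ : ℝ) - 2 * (d₁ : ℝ))) := ⟨_, rfl⟩
  obtain ⟨u₁, hu1⟩ : ∃ u₁ : ℝ, u₁ =
      (3 * (-9 * (d₂ : ℝ) * ((d₂ : ℝ) + 2 * (d₁ : ℝ)) * (2 * (d₂ : ℝ) + (d₁ : ℝ))) * (((d₂ : ℝ) - 2 * (d₁ : ℝ)) * ((d₂ : ℝ) - 3
      * (d₁ : ℝ))) - 4 * (9 * (d₁ : ℝ) * ((d₂ : ℝ) + 2 * (d₁ : ℝ)) * (2 * (d₂ : ℝ) + (d₁ : ℝ))) * ((2 * (d₂ : ℝ) - (d₁ : ℝ)) * (3 * (d₂ : ℝ)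
      - (d₁ : ℝ)))) := ⟨_, rfl⟩
  obtain ⟨v₁, hv1⟩ : ∃ v₁ : ℝ, v₁ =
      (-((9 * (d₁ : ℝ) * ((d₂ : ℝ) + 2 * (d₁ : ℝ)) * (2 * (d₂ : ℝ) + (d₁ : ℝ))) * ((2 * (d₂ : ℝ) - (d₁ : ℝ)) * (3 * (d₂ : ℝ) - (d₁ : ℝ))))) := ⟨_, rfl⟩
  obtain ⟨u₂, hu2⟩ : ∃ u₂ : ℝ, u₂ =
      (9 * (9 * (d₂ : ℝ) ^ 2 * ((d₂ : ℝ) + (d₁ : ℝ)) * ((d₂ : ℝ) + 2 * (d₁ : ℝ)) * (2 * (d₂ : ℝ) + (d₁ : ℝ))) * (2 * (d₂ : ℝ) - 3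
      * (d₁ : ℝ)) - 12 * (-36 * (d₁ : ℝ) * (d₂ : ℝ) * ((d₂ : ℝ) + 2 * (d₁ : ℝ)) * (2 * (d₂ : ℝ) + (d₁ : ℝ))) * ((3 * (d₂ : ℝ) - 2 * (d₁ : ℝ)) * (2
      * (d₂ : ℝ) - 3 * (d₁ : ℝ))) + 23 * (-9 * (d₁ : ℝ) ^ 2 * ((d₂ : ℝ) + (d₁ : ℝ)) * ((d₂ : ℝ) + 2 * (d₁ : ℝ)) * (2 * (d₂ : ℝ) + (d₁ : ℝ))) * (3
      * (d₂ : ℝ) - 2 * (d₁ : ℝ))) := ⟨_, rfl⟩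
  obtain ⟨v₂, hv2⟩ : ∃ v₂ : ℝ, v₂ =
      (-3 * (-36 * (d₁ : ℝ) * (d₂ : ℝ) * ((d₂ : ℝ) + 2 * (d₁ : ℝ)) * (2 * (d₂ : ℝ) + (d₁ : ℝ))) * ((3 * (d₂ : ℝ) - 2 * (d₁ : ℝ)) * (2
      * (d₂ : ℝ) - 3 * (d₁ : ℝ))) + 8 * (-9 * (d₁ : ℝ) ^ 2 * ((d₂ : ℝ) + (d₁ : ℝ)) * ((d₂ : ℝ) + 2 * (d₁ : ℝ)) * (2 * (d₂ : ℝ) + (d₁ : ℝ))) * (3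
      * (d₂ : ℝ) - 2 * (d₁ : ℝ))) := ⟨_, rfl⟩
  obtain ⟨u₃, hu3⟩ : ∃ u₃ : ℝ, u₃ =
      (27 * (-((d₂ : ℝ) ^ 3) * ((d₂ : ℝ) + (d₁ : ℝ)) * ((d₂ : ℝ) + 2 * (d₁ : ℝ)) * (2 * (d₂ : ℝ) + (d₁ : ℝ))) * ((2 * (d₂ : ℝ)
      - (d₁ : ℝ)) * (3 * (d₂ : ℝ) - (d₁ : ℝ)) * (3 * (d₂ : ℝ) - 2 * (d₁ : ℝ))) - 36 * (9 * (d₁ : ℝ) * (d₂ : ℝ) ^ 2 * (2 * (d₂ : ℝ) + (d₁ : ℝ)))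
      * (((d₂ : ℝ) - 3 * (d₁ : ℝ)) * (2 * (d₂ : ℝ) - 3 * (d₁ : ℝ)) * (2 * (d₂ : ℝ) - (d₁ : ℝ)) * (3 * (d₂ : ℝ) - (d₁ : ℝ)) * (3 * (d₂ : ℝ) - 2
      * (d₁ : ℝ))) + 69 * (9 * (d₁ : ℝ) ^ 2 * (d₂ : ℝ) * ((d₂ : ℝ) + 2 * (d₁ : ℝ))) * (((d₂ : ℝ) - 2 * (d₁ : ℝ)) * ((d₂ : ℝ) - 3 * (d₁ : ℝ)) * (2
      * (d₂ : ℝ) - 3 * (d₁ : ℝ)) * (3 * (d₂ : ℝ) - (d₁ : ℝ)) * (3 * (d₂ : ℝ) - 2 * (d₁ : ℝ))) - 148 * (-((d₁ : ℝ) ^ 3) * ((d₂ : ℝ) + (d₁ : ℝ))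
      * ((d₂ : ℝ) + 2 * (d₁ : ℝ)) * (2 * (d₂ : ℝ) + (d₁ : ℝ))) * (((d₂ : ℝ) - 2 * (d₁ : ℝ)) * ((d₂ : ℝ) - 3 * (d₁ : ℝ)) * (2 * (d₂ : ℝ) - 3
      * (d₁ : ℝ)))) := ⟨_, rfl⟩
  obtain ⟨v₃, hv3⟩ : ∃ v₃ : ℝ, v₃ =
      (-9 * (9 * (d₁ : ℝ) * (d₂ : ℝ) ^ 2 * (2 * (d₂ : ℝ) + (d₁ : ℝ))) * (((d₂ : ℝ) - 3 * (d₁ : ℝ)) * (2 * (d₂ : ℝ) - 3 * (d₁ : ℝ)) * (2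
      * (d₂ : ℝ) - (d₁ : ℝ)) * (3 * (d₂ : ℝ) - (d₁ : ℝ)) * (3 * (d₂ : ℝ) - 2 * (d₁ : ℝ))) + 24 * (9 * (d₁ : ℝ) ^ 2 * (d₂ : ℝ) * ((d₂ : ℝ) + 2
      * (d₁ : ℝ))) * (((d₂ : ℝ) - 2 * (d₁ : ℝ)) * ((d₂ : ℝ) - 3 * (d₁ : ℝ)) * (2 * (d₂ : ℝ) - 3 * (d₁ : ℝ)) * (3 * (d₂ : ℝ) - (d₁ : ℝ)) * (3
      * (d₂ : ℝ) - 2 * (d₁ : ℝ))) - 55 * (-((d₁ : ℝ) ^ 3) * ((d₂ : ℝ) + (d₁ : ℝ)) * ((d₂ : ℝ) + 2 * (d₁ : ℝ)) * (2 * (d₂ : ℝ) + (d₁ : ℝ)))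
      * (((d₂ : ℝ) - 2 * (d₁ : ℝ)) * ((d₂ : ℝ) - 3 * (d₁ : ℝ)) * (2 * (d₂ : ℝ) - 3 * (d₁ : ℝ)))) := ⟨_, rfl⟩
  have e1 : ((3 : ℝ) • (x₀ ^ d₁ • S₁) + (-(4 + ρ)) • (x₀ ^ d₂ • S₂)).trace * L₁ = u₁ + ρ * v₁ := by
    simp only [Matrix.trace_smul, smul_eq_mul] at C1 C2
    simp only [Matrix.trace_add, Matrix.trace_smul, smul_eq_mul]
    rw [hL1, hu1, hv1]
    linear_combination (3 * (((d₂ : ℝ) - 2 * (d₁ : ℝ)) * ((d₂ : ℝ) - 3 * (d₁ : ℝ)))) * C1 + (-(4 + ρ) * ((2 * (d₂ : ℝ) - (d₁ : ℝ)) * (3 * (d₂ : ℝ)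
        - (d₁ : ℝ)))) * C2
  have e2 : (((3 : ℝ) • (x₀ ^ d₁ • S₁) + (-(4 + ρ)) • (x₀ ^ d₂ • S₂)) 0 0 * ((3 : ℝ) • (x₀ ^ d₁ • S₁) + (-(4 + ρ)) • (x₀ ^ d₂ • S₂)) 1 1
      - ((3 : ℝ) • (x₀ ^ d₁ • S₁) + (-(4 + ρ)) • (x₀ ^ d₂ • S₂)) 0 1 * ((3 : ℝ) • (x₀ ^ d₁ • S₁) + (-(4 + ρ)) • (x₀ ^ d₂ • S₂)) 1 0
      + (((3 : ℝ) • (x₀ ^ d₁ • S₁) + (-(4 + ρ)) • (x₀ ^ d₂ • S₂)) 0 0 * ((3 : ℝ) • (x₀ ^ d₁ • S₁) + (-(4 + ρ)) • (x₀ ^ d₂ • S₂)) 2 2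
      - ((3 : ℝ) • (x₀ ^ d₁ • S₁) + (-(4 + ρ)) • (x₀ ^ d₂ • S₂)) 0 2 * ((3 : ℝ) • (x₀ ^ d₁ • S₁) + (-(4 + ρ)) • (x₀ ^ d₂ • S₂)) 2 0)
      + (((3 : ℝ) • (x₀ ^ d₁ • S₁) + (-(4 + ρ)) • (x₀ ^ d₂ • S₂)) 1 1 * ((3 : ℝ) • (x₀ ^ d₁ • S₁) + (-(4 + ρ)) • (x₀ ^ d₂ • S₂)) 2 2
      - ((3 : ℝ) • (x₀ ^ d₁ • S₁) + (-(4 + ρ)) • (x₀ ^ d₂ • S₂)) 1 2 * ((3 : ℝ) • (x₀ ^ d₁ • S₁) + (-(4 + ρ)) • (x₀ ^ d₂ • S₂)) 2 1)) * L₂ = u₂ + ρ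
      * v₂ := by
    rw [e2_lin_comb, hL2, hu2, hv2]
    simp only [Matrix.smul_apply, smul_eq_mul] at C3 C4 C5 ⊢
    linear_combination (9 * (2 * (d₂ : ℝ) - 3 * (d₁ : ℝ))) * C3 + (3 * (-(4 + ρ)) * ((3 * (d₂ : ℝ) - 2 * (d₁ : ℝ)) * (2 * (d₂ : ℝ) - 3
        * (d₁ : ℝ)))) * C4 + ((4 + ρ) ^ 2 * (3 * (d₂ : ℝ) - 2 * (d₁ : ℝ))) * C5
      + ((-9 * (d₁ : ℝ) ^ 2 * ((d₂ : ℝ) + (d₁ : ℝ)) * ((d₂ : ℝ) + 2 * (d₁ : ℝ)) * (2 * (d₂ : ℝ) + (d₁ : ℝ))) * (3 * (d₂ : ℝ) - 2 * (d₁ : ℝ))) * hρ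
  have e3 : ((3 : ℝ) • (x₀ ^ d₁ • S₁) + (-(4 + ρ)) • (x₀ ^ d₂ • S₂)).det * L₃ = u₃ + ρ * v₃ := by
    rw [det_lin_comb, hL3, hu3, hv3]
    linear_combination (27 * ((2 * (d₂ : ℝ) - (d₁ : ℝ)) * (3 * (d₂ : ℝ) - (d₁ : ℝ)) * (3 * (d₂ : ℝ) - 2 * (d₁ : ℝ)))) * C6 + (-(9 * (4 + ρ))
        * (((d₂ : ℝ) - 3 * (d₁ : ℝ)) * (2 * (d₂ : ℝ) - 3 * (d₁ : ℝ)) * (2 * (d₂ : ℝ) - (d₁ : ℝ)) * (3 * (d₂ : ℝ) - (d₁ : ℝ)) * (3 * (d₂ : ℝ) - 2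
        * (d₁ : ℝ)))) * C7 + (3 * (4 + ρ) ^ 2 * (((d₂ : ℝ) - 2 * (d₁ : ℝ)) * ((d₂ : ℝ) - 3 * (d₁ : ℝ)) * (2 * (d₂ : ℝ) - 3 * (d₁ : ℝ)) * (3
        * (d₂ : ℝ) - (d₁ : ℝ)) * (3 * (d₂ : ℝ) - 2 * (d₁ : ℝ)))) * C8
      + (-((4 + ρ) ^ 3) * (((d₂ : ℝ) - 2 * (d₁ : ℝ)) * ((d₂ : ℝ) - 3 * (d₁ : ℝ)) * (2 * (d₂ : ℝ) - 3 * (d₁ : ℝ)))) * C9 + (3 * (9 * (d₁ : ℝ) ^ 2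
          * (d₂ : ℝ) * ((d₂ : ℝ) + 2 * (d₁ : ℝ))) * (((d₂ : ℝ) - 2 * (d₁ : ℝ)) * ((d₂ : ℝ) - 3 * (d₁ : ℝ)) * (2 * (d₂ : ℝ) - 3 * (d₁ : ℝ)) * (3
          * (d₂ : ℝ) - (d₁ : ℝ)) * (3 * (d₂ : ℝ) - 2 * (d₁ : ℝ))) - (12 + ρ) * (-((d₁ : ℝ) ^ 3) * ((d₂ : ℝ) + (d₁ : ℝ)) * ((d₂ : ℝ) + 2 * (d₁ : ℝ))
          * (2 * (d₂ : ℝ) + (d₁ : ℝ))) * (((d₂ : ℝ) - 2 * (d₁ : ℝ)) * ((d₂ : ℝ) - 3 * (d₁ : ℝ)) * (2 * (d₂ : ℝ) - 3 * (d₁ : ℝ)))) * hρ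
  have hL1ne : L₁ ≠ 0 := by rw [hL1]; exact mul_ne_zero (mul_ne_zero (mul_ne_zero (mul_ne_zero p1.ne' p4.ne') p6.ne') n2) n3
  have hL2ne : L₂ ≠ 0 := by
    rw [hL2]; exact mul_ne_zero (mul_ne_zero (mul_ne_zero (mul_ne_zero (pow_ne_zero _ p1.ne') n2) p4.ne') p6'.ne') p5.ne'
  have hL3ne : L₃ ≠ 0 := by
    rw [hL3]
    exact mul_ne_zero (mul_ne_zero (mul_ne_zero (mul_ne_zero (mul_ne_zero (mul_ne_zero (pow_ne_zero _ p1.ne') n2) n3)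
      p5.ne') p4.ne') p6.ne') p6'.ne'
  obtain ⟨P₁, hP1⟩ : ∃ P₁ : ℝ, P₁ =
      u₁ + ρ * v₁ := ⟨_, rfl⟩
  obtain ⟨P₂, hP2⟩ : ∃ P₂ : ℝ, P₂ =
      u₂ + ρ * v₂ := ⟨_, rfl⟩
  obtain ⟨P₃, hP3⟩ : ∃ P₃ : ℝ, P₃ =
      u₃ + ρ * v₃ := ⟨_, rfl⟩
  obtain ⟨E1, hE1⟩ : ∃ E1 : ℝ, E1 =
      ((3 : ℝ) • (x₀ ^ d₁ • S₁) + (-(4 + ρ)) • (x₀ ^ d₂ • S₂)).trace := ⟨_, rfl⟩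
  obtain ⟨E2, hE2⟩ : ∃ E2 : ℝ, E2 =
      (((3 : ℝ) • (x₀ ^ d₁ • S₁) + (-(4 + ρ)) • (x₀ ^ d₂ • S₂)) 0 0 * ((3 : ℝ) • (x₀ ^ d₁ • S₁) + (-(4 + ρ)) • (x₀ ^ d₂ • S₂)) 1 1
      - ((3 : ℝ) • (x₀ ^ d₁ • S₁) + (-(4 + ρ)) • (x₀ ^ d₂ • S₂)) 0 1 * ((3 : ℝ) • (x₀ ^ d₁ • S₁) + (-(4 + ρ)) • (x₀ ^ d₂ • S₂)) 1 0
      + (((3 : ℝ) • (x₀ ^ d₁ • S₁) + (-(4 + ρ)) • (x₀ ^ d₂ • S₂)) 0 0 * ((3 : ℝ) • (x₀ ^ d₁ • S₁) + (-(4 + ρ)) • (x₀ ^ d₂ • S₂)) 2 2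
      - ((3 : ℝ) • (x₀ ^ d₁ • S₁) + (-(4 + ρ)) • (x₀ ^ d₂ • S₂)) 0 2 * ((3 : ℝ) • (x₀ ^ d₁ • S₁) + (-(4 + ρ)) • (x₀ ^ d₂ • S₂)) 2 0)
      + (((3 : ℝ) • (x₀ ^ d₁ • S₁) + (-(4 + ρ)) • (x₀ ^ d₂ • S₂)) 1 1 * ((3 : ℝ) • (x₀ ^ d₁ • S₁) + (-(4 + ρ)) • (x₀ ^ d₂ • S₂)) 2 2
      - ((3 : ℝ) • (x₀ ^ d₁ • S₁) + (-(4 + ρ)) • (x₀ ^ d₂ • S₂)) 1 2 * ((3 : ℝ) • (x₀ ^ d₁ • S₁) + (-(4 + ρ)) • (x₀ ^ d₂ • S₂)) 2 1)) := ⟨_, rfl⟩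
  obtain ⟨E3, hE3⟩ : ∃ E3 : ℝ, E3 =
      ((3 : ℝ) • (x₀ ^ d₁ • S₁) + (-(4 + ρ)) • (x₀ ^ d₂ • S₂)).det := ⟨_, rfl⟩
  have hD' : 0 ≤ 18 * (-E1) * E2 * (-E3) - 4 * (-E1) ^ 3 * (-E3) + (-E1) ^ 2 * E2 ^ 2 - 4 * E2 ^ 3 - 27 * (-E3) ^ 2 := by
    rw [hE1, hE2, hE3]; exact hD
  have e1' : E1 * L₁ = P₁ := by rw [hE1, hP1]; exact e1
  have e2' : E2 * L₂ = P₂ := by rw [hE2, hP2]; exact e2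
  have e3' : E3 * L₃ = P₃ := by rw [hE3, hP3]; exact e3
  have key : (18 * (-E1) * E2 * (-E3) - 4 * (-E1) ^ 3 * (-E3) + (-E1) ^ 2 * E2 ^ 2 - 4 * E2 ^ 3 - 27 * (-E3) ^ 2)
        * ((L₁ * L₂) ^ 2 * L₃) ^ 2
      = 18 * P₁ * P₂ * P₃ * L₁ ^ 3 * L₂ ^ 3 * L₃ - 4 * P₁ ^ 3 * P₃ * L₁ * L₂ ^ 4 * L₃ + P₁ ^ 2 * P₂ ^ 2 * L₁ ^ 2 * L₂ ^ 2 * L₃ ^ 2 - 4 * P₂ ^ 3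
          * L₁ ^ 4 * L₂ * L₃ ^ 2 - 27 * P₃ ^ 2 * L₁ ^ 4 * L₂ ^ 4 := by
    linear_combination
      (18 * (E2 * L₂) * (E3 * L₃) * (L₁ ^ 3 * L₂ ^ 3 * L₃)
        - 4 * ((E1 * L₁) ^ 2 + (E1 * L₁) * P₁ + P₁ ^ 2) * (E3 * L₃) * (L₁ * L₂ ^ 4 * L₃)
        + ((E1 * L₁) + P₁) * (E2 * L₂) ^ 2 * (L₁ ^ 2 * L₂ ^ 2 * L₃ ^ 2)) * e1'
      + (18 * P₁ * (E3 * L₃) * (L₁ ^ 3 * L₂ ^ 3 * L₃) + P₁ ^ 2 * ((E2 * L₂) + P₂) * (L₁ ^ 2 * L₂ ^ 2 * L₃ ^ 2)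
        - 4 * ((E2 * L₂) ^ 2 + (E2 * L₂) * P₂ + P₂ ^ 2) * (L₁ ^ 4 * L₂ * L₃ ^ 2)) * e2'
      + (18 * P₁ * P₂ * (L₁ ^ 3 * L₂ ^ 3 * L₃) - 4 * P₁ ^ 3 * (L₁ * L₂ ^ 4 * L₃) - 27 * ((E3 * L₃) + P₃) * (L₁ ^ 4 * L₂ ^ 4)) * e3'
  have hM : 0 ≤ ((L₁ * L₂) ^ 2 * L₃) ^ 2 := sq_nonneg _
  have hnn : 0 ≤ 18 * P₁ * P₂ * P₃ * L₁ ^ 3 * L₂ ^ 3 * L₃ - 4 * P₁ ^ 3 * P₃ * L₁ * L₂ ^ 4 * L₃ + P₁ ^ 2 * P₂ ^ 2 * L₁ ^ 2 * L₂ ^ 2 * L₃ ^ 2 - 4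
      * P₂ ^ 3 * L₁ ^ 4 * L₂ * L₃ ^ 2 - 27 * P₃ ^ 2 * L₁ ^ 4 * L₂ ^ 4 := by
    rw [← key]; exact mul_nonneg hD' hM
  -- reduction modulo ρ² = 7 at the level of the atoms
  have hred := wall_reduction u₁ v₁ u₂ v₂ u₃ v₃ L₁ L₂ L₃ ρ P₁ P₂ P₃ hρ hP1 hP2 hP3
  have hA : 18 * L₁^3 * L₂^3 * L₃ * (u₁*u₂*u₃ + 7 * (u₁*v₂*v₃ + v₁*u₂*v₃ + v₁*v₂*u₃) + 49 * 0) + (-4) * L₁ * L₂^4 * L₃ * (u₁^3*u₃ + 7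
      * (3*u₁^2*v₁*v₃ + 3*u₁*v₁^2*u₃) + 49 * v₁^3*v₃) + L₁^2 * L₂^2 * L₃^2 * (u₁^2*u₂^2 + 7 * (u₁^2*v₂^2 + 4*u₁*v₁*u₂*v₂ + v₁^2*u₂^2) + 49
      * v₁^2*v₂^2) + (-4) * L₁^4 * L₂ * L₃^2 * (u₂^3 + 7 * 3*u₂*v₂^2 + 49 * 0) + (-27) * L₁^4 * L₂^4 * (u₃^2 + 7 * v₃^2 + 49 * 0)
      = -(529200 * ((d₁ : ℝ) ^ 6 * (d₂ : ℝ) ^ 6 * ((d₂ : ℝ) - (d₁ : ℝ)) ^ 12 * (2 * (d₁ : ℝ) - (d₂ : ℝ)) ^ 7 * (2 * (d₂ : ℝ) - (d₁ : ℝ)) ^ 7 * (2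
          * (d₂ : ℝ) - 3 * (d₁ : ℝ)) ^ 3 * (3 * (d₂ : ℝ) - 2 * (d₁ : ℝ)) ^ 3 * ((d₂ : ℝ) - 3 * (d₁ : ℝ)) ^ 2 * (3 * (d₂ : ℝ) - (d₁ : ℝ)) ^ 2)
          * ((-59525894244) * (d₁ : ℝ) ^ 14 + (463050662104) * (d₁ : ℝ) ^ 13 * (d₂ : ℝ) + (-1338534940339) * (d₁ : ℝ) ^ 12 * (d₂ : ℝ) ^ 2
          + (1362621789444) * (d₁ : ℝ) ^ 11 * (d₂ : ℝ) ^ 3 + (993632267146) * (d₁ : ℝ) ^ 10 * (d₂ : ℝ) ^ 4 + (-2964615634660) * (d₁ : ℝ) ^ 9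
          * (d₂ : ℝ) ^ 5 + (600149827125) * (d₁ : ℝ) ^ 8 * (d₂ : ℝ) ^ 6 + (2673509222000) * (d₁ : ℝ) ^ 7 * (d₂ : ℝ) ^ 7 + (-1838103286325)
          * (d₁ : ℝ) ^ 6 * (d₂ : ℝ) ^ 8 + (-659250033660) * (d₁ : ℝ) ^ 5 * (d₂ : ℝ) ^ 9 + (1139411739446) * (d₁ : ℝ) ^ 4 * (d₂ : ℝ) ^ 10
          + (-206564521556) * (d₁ : ℝ) ^ 3 * (d₂ : ℝ) ^ 11 + (-318452034189) * (d₁ : ℝ) ^ 2 * (d₂ : ℝ) ^ 12 + (200622496104) * (d₁ : ℝ)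
          * (d₂ : ℝ) ^ 13 + (-35475698844) * (d₂ : ℝ) ^ 14)) := by
    rw [hL1, hL2, hL3, hu1, hv1, hu2, hv2, hu3, hv3]
    ring
  have hB : 18 * L₁^3 * L₂^3 * L₃ * ((u₁*u₂*v₃ + u₁*v₂*u₃ + v₁*u₂*u₃) + 7 * v₁*v₂*v₃) + (-4) * L₁ * L₂^4 * L₃ * ((u₁^3*v₃ + 3*u₁^2*v₁*u₃) + 7
      * (3*u₁*v₁^2*v₃ + v₁^3*u₃)) + L₁^2 * L₂^2 * L₃^2 * ((2*u₁^2*u₂*v₂ + 2*u₁*v₁*u₂^2) + 7 * (2*u₁*v₁*v₂^2 + 2*v₁^2*u₂*v₂)) + (-4) * L₁^4 * L₂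
      * L₃^2 * (3*u₂^2*v₂ + 7 * v₂^3) + (-27) * L₁^4 * L₂^4 * (2*u₃*v₃ + 7 * 0)
      = -(5292000 * ((d₁ : ℝ) ^ 6 * (d₂ : ℝ) ^ 6 * ((d₂ : ℝ) - (d₁ : ℝ)) ^ 12 * (2 * (d₁ : ℝ) - (d₂ : ℝ)) ^ 7 * (2 * (d₂ : ℝ) - (d₁ : ℝ)) ^ 7 * (2
          * (d₂ : ℝ) - 3 * (d₁ : ℝ)) ^ 3 * (3 * (d₂ : ℝ) - 2 * (d₁ : ℝ)) ^ 4 * ((d₂ : ℝ) - 3 * (d₁ : ℝ)) ^ 2 * (3 * (d₂ : ℝ) - (d₁ : ℝ)) ^ 2)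
          * ((1113747900) * (d₁ : ℝ) ^ 13 + (-7017297452) * (d₁ : ℝ) ^ 12 * (d₂ : ℝ) + (14671752647) * (d₁ : ℝ) ^ 11 * (d₂ : ℝ) ^ 2 + (-3813259764)
          * (d₁ : ℝ) ^ 10 * (d₂ : ℝ) ^ 3 + (-24136023938) * (d₁ : ℝ) ^ 9 * (d₂ : ℝ) ^ 4 + (19619096618) * (d₁ : ℝ) ^ 8 * (d₂ : ℝ) ^ 5
          + (17497339338) * (d₁ : ℝ) ^ 7 * (d₂ : ℝ) ^ 6 + (-23430682618) * (d₁ : ℝ) ^ 6 * (d₂ : ℝ) ^ 7 + (-212204738) * (d₁ : ℝ) ^ 5 * (d₂ : ℝ) ^ 8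
          + (11193902178) * (d₁ : ℝ) ^ 4 * (d₂ : ℝ) ^ 9 + (-4427276077) * (d₁ : ℝ) ^ 3 * (d₂ : ℝ) ^ 10 + (-2300819210) * (d₁ : ℝ) ^ 2
          * (d₂ : ℝ) ^ 11 + (2139681684) * (d₁ : ℝ) * (d₂ : ℝ) ^ 12 + (-434322936) * (d₂ : ℝ) ^ 13)) := by
    rw [hL1, hL2, hL3, hu1, hv1, hu2, hv2, hu3, hv3]
    ring
  have hAneg : 18 * L₁^3 * L₂^3 * L₃ * (u₁*u₂*u₃ + 7 * (u₁*v₂*v₃ + v₁*u₂*v₃ + v₁*v₂*u₃) + 49 * 0) + (-4) * L₁ * L₂^4 * L₃ * (u₁^3*u₃ + 7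
      * (3*u₁^2*v₁*v₃ + 3*u₁*v₁^2*u₃) + 49 * v₁^3*v₃) + L₁^2 * L₂^2 * L₃^2 * (u₁^2*u₂^2 + 7 * (u₁^2*v₂^2 + 4*u₁*v₁*u₂*v₂ + v₁^2*u₂^2) + 49
      * v₁^2*v₂^2) + (-4) * L₁^4 * L₂ * L₃^2 * (u₂^3 + 7 * 3*u₂*v₂^2 + 49 * 0) + (-27) * L₁^4 * L₂^4 * (u₃^2 + 7 * v₃^2 + 49 * 0) < 0 := by
    rw [hA]; exact neg_neg_of_pos (mul_pos (mul_pos (by norm_num : (0:ℝ) < 529200) hprefA) hRA)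
  have hBneg : 18 * L₁^3 * L₂^3 * L₃ * ((u₁*u₂*v₃ + u₁*v₂*u₃ + v₁*u₂*u₃) + 7 * v₁*v₂*v₃) + (-4) * L₁ * L₂^4 * L₃ * ((u₁^3*v₃ + 3*u₁^2*v₁*u₃) + 7
      * (3*u₁*v₁^2*v₃ + v₁^3*u₃)) + L₁^2 * L₂^2 * L₃^2 * ((2*u₁^2*u₂*v₂ + 2*u₁*v₁*u₂^2) + 7 * (2*u₁*v₁*v₂^2 + 2*v₁^2*u₂*v₂)) + (-4) * L₁^4 * L₂
      * L₃^2 * (3*u₂^2*v₂ + 7 * v₂^3) + (-27) * L₁^4 * L₂^4 * (2*u₃*v₃ + 7 * 0) < 0 := by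
    rw [hB]; exact neg_neg_of_pos (mul_pos (mul_pos (by norm_num : (0:ℝ) < 5292000) hprefB) hRB)
  rw [hred] at hnn
  exact absurd hnn (not_le.mpr (add_neg hAneg (mul_neg_of_pos_of_neg hρ0 hBneg)))

/-- **NO NINEFOLD ROOT ON THE WHOLE OPEN CHAMBER III** (`3d₁ < 2d₂`, `d₂ < 2d₁`; ALL such supports; symmetric letters; any `x₀`):
Newton's certificate (`not_ninefold_root_chamber_III`, `10d₂ ≤ 19d₁`) and the wall direction (`not_ninefold_root_chamber_III_wall`,
`9d₁ ≤ 5d₂`) cover it together. [folklore] -/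
theorem not_ninefold_root_chamber_III' (d₁ d₂ : ℕ) (S₁ S₂ : Matrix (Fin 3) (Fin 3) ℝ) (hlo : 3 * d₁ < 2 * d₂) (hhi : d₂ < 2 * d₁)
    (hS₁ : S₁.IsSymm) (hS₂ : S₂.IsSymm) (x₀ : ℝ) :
    ¬ (X - C x₀) ^ 9 ∣ (∑ l, (X : ℝ[X]) ^ (![0, d₁, d₂] : Fin 3 → ℕ) l • ((![1, S₁, S₂] : Fin 3 → Matrix (Fin 3) (Fin 3) ℝ) l).map C).det := by
  by_cases h19 : 10 * d₂ ≤ 19 * d₁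
  · exact not_ninefold_root_chamber_III d₁ d₂ S₁ S₂ hlo h19 hS₁ hS₂ x₀
  · exact not_ninefold_root_chamber_III_wall d₁ d₂ S₁ S₂ (by omega) hhi hS₁ hS₂ x₀

/-! ## 8. Chambers I and II at once (`d₂ > 2d₁`, wall `d₂ = 3d₁` included): `(tr S₁)² < 3e₂(S₁)` -/

/-- For a real SYMMETRIC `3 × 3` matrix, `3·e₂(A) ≤ (tr A)²` — a sum of squares of entries:
`(tr A)² − 3e₂(A) = ½Σ_{i<j}(A_ii − A_jj)² + 3Σ_{i<j}A_ij²`. [folklore] -/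
theorem three_e2_le_trace_sq_of_isSymm (A : Matrix (Fin 3) (Fin 3) ℝ) (hA : A.IsSymm) :
    3 * (A 0 0 * A 1 1 - A 0 1 * A 1 0 + (A 0 0 * A 2 2 - A 0 2 * A 2 0) + (A 1 1 * A 2 2 - A 1 2 * A 2 1)) ≤ A.trace ^ 2 := by
  have h10 : A 1 0 = A 0 1 := hA.apply 0 1
  have h20 : A 2 0 = A 0 2 := hA.apply 0 2
  have h21 : A 2 1 = A 1 2 := hA.apply 1 2
  rw [Matrix.trace_fin_three, h10, h20, h21]
  nlinarith [sq_nonneg (A 0 0 - A 1 1), sq_nonneg (A 0 0 - A 2 2), sq_nonneg (A 1 1 - A 2 2),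
    sq_nonneg (A 0 1), sq_nonneg (A 0 2), sq_nonneg (A 1 2)]

/-- **NO NINEFOLD ROOT WHEN `d₂ > 2d₁` (chambers I and II and the wall `d₂ = 3d₁`; ALL such supports).**  For any support with
`0 < d₁`, `2d₁ < d₂`, any real SYMMETRIC middle letter `S₁`, ANY real top letter `S₂` and any `x₀`:
`(X − x₀)⁹ ∤ det(1 + X^{d₁}S₁ + X^{d₂}S₂)`.  The confluent coefficient table forces
`(tr S₁)² − 3e₂(S₁) = −135·s²(s+2)(2s+1)(13s²−s−5)/((s−1)²(2s−1)²(3s−1)²(s−2)(3s−2)) < 0` (`s = d₂/d₁ > 2`), against the sum of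
squares `three_e2_le_trace_sq_of_isSymm` — the middle letter alone cannot be symmetric.  (Supersedes `not_ninefold_root_chamber_I`
of part 4 and upgrades chamber II from «pseudoline contact» to «impossible» for a symmetric middle letter.) [folklore] -/
theorem not_ninefold_root_of_two_mul_lt (d₁ d₂ : ℕ) (S₁ S₂ : Matrix (Fin 3) (Fin 3) ℝ) (h0 : 0 < d₁) (h2 : 2 * d₁ < d₂)
    (hS₁ : S₁.IsSymm) (x₀ : ℝ) :
    ¬ (X - C x₀) ^ 9 ∣ (∑ l, (X : ℝ[X]) ^ (![0, d₁, d₂] : Fin 3 → ℕ) l • ((![1, S₁, S₂] : Fin 3 → Matrix (Fin 3) (Fin 3) ℝ) l).map C).det := by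
  intro h9
  have h := dvd_comp_scale h9
  rw [det_pencil_comp_scale] at h
  obtain ⟨C1, -, C3, -, -, -, -, -, -⟩ := confluent_coefficients d₁ d₂ (x₀ ^ d₁ • S₁) (x₀ ^ d₂ • S₂) h0 (by omega) h
  have hT : (x₀ ^ d₁ • S₁).IsSymm := hS₁.smul _
  have ha : (0 : ℝ) < d₁ := by exact_mod_cast h0
  have h2' : 2 * (d₁ : ℝ) < d₂ := by exact_mod_cast h2
  have p1 : 0 < (d₂ : ℝ) - (d₁ : ℝ) := by linarith
  have p2 : 0 < (d₂ : ℝ) - 2 * (d₁ : ℝ) := by linarith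
  have p4 : 0 < 2 * (d₂ : ℝ) - (d₁ : ℝ) := by linarith
  have p6' : 0 < 3 * (d₂ : ℝ) - 2 * (d₁ : ℝ) := by linarith
  have p7 : 0 < (d₂ : ℝ) := by linarith
  have p6 : 0 < 3 * (d₂ : ℝ) - (d₁ : ℝ) := by linarith
  have p9 : 0 < (d₂ : ℝ) + 2 * (d₁ : ℝ) := by linarith
  have p10 : 0 < 2 * (d₂ : ℝ) + (d₁ : ℝ) := by linarith
  have hq : 0 < 13 * (d₂ : ℝ) ^ 2 - (d₁ : ℝ) * (d₂ : ℝ) - 5 * (d₁ : ℝ) ^ 2 := by nlinarith [mul_pos ha p2, sq_nonneg ((d₂ : ℝ) - 2 * (d₁ : ℝ))]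
  set T : Matrix (Fin 3) (Fin 3) ℝ := (x₀ ^ d₁ • S₁) with hT_def
  have hsos := three_e2_le_trace_sq_of_isSymm T hT
  have key : (T.trace ^ 2 - 3 * (T 0 0 * T 1 1 - T 0 1 * T 1 0 + (T 0 0 * T 2 2 - T 0 2 * T 2 0) + (T 1 1 * T 2 2 - T 1 2 * T 2 1))) * ((((d₂ : ℝ) - (d₁ : ℝ)) * (2 * (d₂ : ℝ) - (d₁ : ℝ)) * (3 * (d₂ : ℝ) - (d₁ : ℝ))) ^ 2 * (((d₂ : ℝ) - (d₁ : ℝ)) ^ 2 * ((d₂ : ℝ) - 2 * (d₁ : ℝ)) * (2 * (d₂ : ℝ) - (d₁ : ℝ)) * (3 * (d₂ : ℝ) - 2 * (d₁ : ℝ))))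
      = -135 * (d₁ : ℝ) ^ 2 * (d₂ : ℝ) ^ 2 * ((d₂ : ℝ) + 2 * (d₁ : ℝ)) * (2 * (d₂ : ℝ) + (d₁ : ℝ)) * (13 * (d₂ : ℝ) ^ 2 - (d₁ : ℝ) * (d₂ : ℝ) - 5 * (d₁ : ℝ) ^ 2) * ((d₂ : ℝ) - (d₁ : ℝ)) ^ 2 * (2 * (d₂ : ℝ) - (d₁ : ℝ)) := by
    linear_combination ((((d₂ : ℝ) - (d₁ : ℝ)) ^ 2 * ((d₂ : ℝ) - 2 * (d₁ : ℝ)) * (2 * (d₂ : ℝ) - (d₁ : ℝ)) * (3 * (d₂ : ℝ) - 2 * (d₁ : ℝ))) * (T.trace * (((d₂ : ℝ) - (d₁ : ℝ)) * (2 * (d₂ : ℝ) - (d₁ : ℝ)) * (3 * (d₂ : ℝ) - (d₁ : ℝ))) + (-9 * (d₂ : ℝ) * ((d₂ : ℝ) + 2 * (d₁ : ℝ)) * (2 * (d₂ : ℝ) + (d₁ : ℝ))))) * C1 - (3 * (((d₂ : ℝ) - (d₁ : ℝ)) * (2 * (d₂ : ℝ) - (d₁ : ℝ)) * (3 * (d₂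 : ℝ) - (d₁ : ℝ))) ^ 2) * C3
  have hm : 0 < (((d₂ : ℝ) - (d₁ : ℝ)) * (2 * (d₂ : ℝ) - (d₁ : ℝ)) * (3 * (d₂ : ℝ) - (d₁ : ℝ))) ^ 2 * (((d₂ : ℝ) - (d₁ : ℝ)) ^ 2 * ((d₂ : ℝ) - 2 * (d₁ : ℝ)) * (2 * (d₂ : ℝ) - (d₁ : ℝ)) * (3 * (d₂ : ℝ) - 2 * (d₁ : ℝ))) := by positivity
  have hnn : 0 ≤ (T.trace ^ 2 - 3 * (T 0 0 * T 1 1 - T 0 1 * T 1 0 + (T 0 0 * T 2 2 - T 0 2 * T 2 0) + (T 1 1 * T 2 2 - T 1 2 * T 2 1))) * ((((d₂ : ℝ) - (d₁ : ℝ)) * (2 * (d₂ : ℝ) - (d₁ : ℝ)) * (3 * (d₂ : ℝ) - (d₁ : ℝ))) ^ 2 * (((d₂ : ℝ) - (d₁ : ℝ)) ^ 2 * ((d₂ : ℝ) - 2 * (d₁ : ℝ)) * (2 * (d₂ : ℝ) - (d₁ : ℝ)) * (3 * (d₂ : ℝ) - 2 * (d₁ : ℝ)))) := mul_nonneg (sub_nonneg.mpr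 hsos) hm.le
  have hneg : -135 * (d₁ : ℝ) ^ 2 * (d₂ : ℝ) ^ 2 * ((d₂ : ℝ) + 2 * (d₁ : ℝ)) * (2 * (d₂ : ℝ) + (d₁ : ℝ)) * (13 * (d₂ : ℝ) ^ 2 - (d₁ : ℝ) * (d₂ : ℝ) - 5 * (d₁ : ℝ) ^ 2) * ((d₂ : ℝ) - (d₁ : ℝ)) ^ 2 * (2 * (d₂ : ℝ) - (d₁ : ℝ)) < 0 := by
    have : 0 < 135 * (d₁ : ℝ) ^ 2 * (d₂ : ℝ) ^ 2 * ((d₂ : ℝ) + 2 * (d₁ : ℝ)) * (2 * (d₂ : ℝ) + (d₁ : ℝ)) * (13 * (d₂ : ℝ) ^ 2 - (d₁ : ℝ) * (d₂ : ℝ) - 5 * (d₁ : ℝ) ^ 2) * ((d₂ : ℝ) - (d₁ : ℝ)) ^ 2 * (2 * (d₂ : ℝ) - (d₁ : ℝ)) := by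
      positivity
    linarith
  rw [key] at hnn
  exact absurd hnn (not_le.mpr hneg)

/-! ## 7. Every support off the walls: the coalesced nine is never of PSD type -/

/-- **THE COALESCED CORNER OF CLAIM L, ALL SUPPORTS.**  For EVERY support `0 < d₁ < d₂` off the two walls `d₂ = 2d₁` and
`2d₂ = 3d₁`, all real SYMMETRIC letters `S₁, S₂` and every `x₀`: if `(X − x₀)⁹` divides `det(1 + X^{d₁}S₁ + X^{d₂}S₂)` then
`F(x₀) = 1 + x₀^{d₁}S₁ + x₀^{d₂}S₂` is NOT positive semidefinite — a ninefold positive root of a definite-bottom `(3,3)` row is never a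
coalescence of nine PSD-singular points.  (`d₂ > 2d₁`: no ninefold root at all, `not_ninefold_root_of_two_mul_lt`; chamber III
`3d₁ < 2d₂ < 4d₁`: none either, `not_ninefold_root_chamber_III'`; chamber IV `2d₂ < 3d₁`: pseudoline contact, part 2.) [folklore] -/
theorem not_posSemidef_of_ninefold_root_offwalls (d₁ d₂ : ℕ) (S₁ S₂ : Matrix (Fin 3) (Fin 3) ℝ) (h0 : 0 < d₁) (h01 : d₁ < d₂)
    (hw2 : d₂ ≠ 2 * d₁) (hw32 : 2 * d₂ ≠ 3 * d₁) (hS₁ : S₁.IsSymm) (hS₂ : S₂.IsSymm) (x₀ : ℝ)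
    (h9 : (X - C x₀) ^ 9 ∣ (∑ l, (X : ℝ[X]) ^ (![0, d₁, d₂] : Fin 3 → ℕ) l • ((![1, S₁, S₂] : Fin 3 → Matrix (Fin 3) (Fin 3) ℝ) l).map C).det) :
    ¬ (1 + x₀ ^ d₁ • S₁ + x₀ ^ d₂ • S₂).PosSemidef := by
  rcases Nat.lt_or_ge (2 * d₂) (3 * d₁) with hIV | hIV
  · exact (not_posSemidef_of_ninefold_root d₁ d₂ S₁ S₂ (Or.inl ⟨h01, hIV⟩) x₀ h9).1
  rcases Nat.lt_or_ge d₂ (2 * d₁) with hIII | hIII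
  · exact absurd h9 (not_ninefold_root_chamber_III' d₁ d₂ S₁ S₂ (by omega) hIII hS₁ hS₂ x₀)
  · exact absurd h9 (not_ninefold_root_of_two_mul_lt d₁ d₂ S₁ S₂ h0 (by omega) hS₁ x₀)

end Summit.ValiantsHypothesis.ValiantsHypothesis.Theorems.LacunarySymmetroidMatrixDescartes.Census.ConfluentNine
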